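import Summits.BirchSwinnertonDyer.Rank1Residual.Supersingular.RankOneKimLevelKRecordShapeX7
import Summits.BirchSwinnertonDyer.Rank1Residual.Supersingular.IntModelMinimalityKrausTwoMore
import Summits.BirchSwinnertonDyer.Rank1Residual.Supersingular.RankOneSurjThreeCertificates_11
import Summits.BirchSwinnertonDyer.Rank1Residual.Supersingular.RankOneSurjThreeCertificates_12
import HarnessLib

/-!
# Rank ONE at `p = 3`, `#Ш_an = 9`, `ord₃ ∏c_ℓ = 1`: per-pair RECORDS in the Kim-PRE level-81 currency — `BSD(E,3)` from ONE
# PRIME-level Kurihara number `δ̃⁽⁴⁾_ℓ ≢ 0 (mod 81)` at a cyclic `ℓ ∈ 𝒫_4` (ENGINE K v1.3 depth 4, R1k4 tier) and the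
# two-engine descent count `9 ∣ #Sel^(3)(E/ℚ)`, every side condition DECIDED in the kernel (cell `b2b-bsdres`, supersingular family
# prover B = unit `b2b-bsdres-additive-p3`, gen 24; class lead N6·O3, X7 joint B side; part A: 222784n1, 445280bc1)

HONEST FRAMING (cell `b2b-bsdres-*`, verbatim): prove what is provable now; shrink each hard class to its core with data;
no claim beyond stated classes; COMBINATION classes deleted from PUBLISHED theorems only, CONSTRUCTION-shaped remainder
typed; this is not "finishing BSD". X7 / X8 stay CONSTRUCTION-SHAPED; NOT class theorems; nothing is booked; O3's / O4's marks
do not move. EVERY theorem below is CONDITIONAL on the ANNOUNCED preprint C.-H. Kim (app. R. Pollack), arXiv:2505.09121 Thm. 1.1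
(`hK25s`, OPEN binder) and takes AS BINDERS (i) the non-vanishing `kuriharaNumber D.f 81 ℓ ψ ≠ 0` of ONE level-81 Kurihara number
for a surjective `ψ_ℓ : (ℤ/ℓ)ˣ → ℤ/81` — the kernel does NOT compute that number; ENGINE K v1.3 did (iw-2's `gen12/kp9/engKq.py`
sha256 6e4d76b7…, UNCHANGED — twisted `L`-values of the order-81 characters of conductor `ℓ` by the approximate functional equation, exact
orbit sums after certified rounding, certificates feq / round_resid / dft per level; run at depth 4 = iw-2's pre-built `prodR1k4.json` tier,
'next tiers only if a lead asks', by THIS seat as O3 class lead: additive-p3 GEN 24 kit jobs listed per row, task file / outputs mirrored under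
`HOME/b2b-bsdres-additive-p3/g24/kim81/`; ONE engine per level — iw-2 asked for engine M at the same levels, INBOX 2026-08-22) — and (ii) the
descent count `9 ∣ #Sel^(3)(E/ℚ)` = gen 19's TWO-ENGINE 3-descent lower half (`dim Sel₃ ≥ 3` on both engines, EXACT on engine 1; x11b engine 1 /
x10b engine 2, kit j132399 / j132400+j136164; `HOME/b2b-bsdres-additive-p3/g19/sha9core/R1SHA2-TABLE.md`). WHY DEPTH 4: on these rows
`ord₃ #Ш_an = 2` AND `ord₃ ∏c_ℓ = 1`, and Kim's Conjecture 1.10 predicts the first non-vanishing prime-level Kurihara number at depth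
`k = ord₃ #Ш + ord₃ ∏c + 1 = 4` — the level-27 numbers of these rows vanished at every prime tabled (cc-eng-3 LEVEL-27 STAGE 1, iw-2 R1k3),
the level-81 numbers below do not (`ord₃ δ̃⁽⁴⁾_ℓ = 3` exactly, as predicted); the consuming shape needs only `k ≤ 4` and NO Tamagawa
hypothesis (`BSD(E,3)` ⟺ `ord₃ #Ш = ord₃ #Ш_an`; Kim's clause at `k = 4` gives `ord₃ #Ш ≤ 3`, the descent bit `≥ 1`, Cassels–Tate
squareness pins `2`). With these records EVERY open O3 `#Ш_an = 9` cell (22/22: 20 level-27 + 2 level-81) carries a Kim-PRE record.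

WHAT THE KERNEL DECIDES PER ROW (shapes `X7RankOne/X8RankOne.bsdp_three_of_kim2025_OPEN_of_ainvs_of_kuriharaNumber_ne_zero_of_card_selmerGroup_of_countPointsFast`,
`RankOneKimLevelKRecordShapeX7.lean`, `k = 4 ≤ 4`, `j = 1`): global minimality of the Cremona model (x11c bounded Kraus), `3 ∤ Δ` and
`#Ẽ(𝔽₃)` (class X8: `∈ {1,7}`; class X7: `3 ∣ 4 − #Ẽ(𝔽₃)` plus an additive prime `q ∣ Δ, q ∣ c₄`), `ℓ ≥ 5` prime, `ℓ ∤ Δ`,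
`ℓ ≡ 1 (mod 81)`, the point count `#Ẽ(𝔽_ℓ) = n_ℓ` by prover A's `countPointsFast` (one piece for `ℓ ≤ 13 177`, else gen 24's chunk
certificate `ChunkSums`, one `decide +kernel` per 12 000-term chunk) with `81 ∣ n_ℓ` (so `ℓ ∈ 𝒫_4`), CYCLICITY `#Ẽ(𝔽_ℓ)[3] ≤ 3` by
the cube test `Δ^{(ℓ−1)/3} ≢ 1 (mod ℓ)` (n1011-p15; NOTE the cheaper candidates `ℓ = 18 307` (202633a1) and `63 667` (421201k1) named
by cc-eng-3 GEN 6 FAIL it — full-3-torsion primes, not Kolyvagin-cyclic — and are not used); surj(3) is gen 21's kernel certificate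
`surj_x7r1_/surj_x8r1_<label>_3`; the 3-adic tower needs no witness. OTHER BINDERS: `hCT`, `hGZK`, `hmod` PUBLISHED; `D`; `r_an = 1`
and `#Ш_an = q` with `ord₃ q = 2` (Cremona allbsd). READING (class lead): on these rows BSD₃ holds modulo (Kim 2025 refereed) +
(the engine's δ̃⁽⁴⁾_ℓ mod 81) + (the two-engine descent count) + published facts — a SECOND conditional route beside the gen-19/20
rem13 + descent records (tier-D composed citation `hK`).

References: [Kim2025RefinedTNC] Thm. 1.1 (ANNOUNCED, OPEN binder); [Kim2022StructureSelmer] §1.2.2, Thm. 1.9 (6), Conj. 1.10;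
[SilvermanAEC2009] III.1, VII.1, VII.5, X.4.2, X.4.14; [IrelandRosen1990] Prop. 5.1.2; [Kraus1989]; [Cremona1997] §3.6;
[Cremona2006] Table 1; [Miller2011LMS] Def. 1.1.
-/

set_option autoImplicit false

noncomputable section

open scoped Classical MatrixGroups ModularForm

open CongruenceSubgroup WeierstrassCurve Literature.NumberTheory.EllipticCurves
  Literature.NumberTheory.EllipticCurves.ModularForms
  Literature.NumberTheory.EllipticCurves.Rank1Residual
  Literature.NumberTheory.EllipticCurves.Rank1Residual.Typed
  Literature.NumberTheory.EllipticCurves.Rank1Residual.X11RankOneCertificates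
  Summit.BirchSwinnertonDyer.BirchSwinnertonDyer.Rank1Residual.X11RankOne

namespace Summit.BirchSwinnertonDyer.Rank1Residual.Supersingular

/-- **`222784n1`** (O4@3 = X7@3 ∧ `r_an = 1`; Cremona model `[0, 0, 0, -821516, 193877776]`, `N = 222784` = 2^6·59^2, `#Ш_an = 9`, `∏c_ℓ = 6` (`ord₃ = 1`: Kim's Conj. 1.10 puts the first non-zero prime-level number at depth `k = ord₃ #Ш + ord₃∏c + 1 = 4` — every level-27 number of this row vanished (cc-eng-3 STAGE 1; engine K R1k3), as predicted), `#E(ℚ)_tors = 1`): `BSD(E,3)` from the level-81 Kurihara number at the prime `ℓ = 5023 ∈ 𝒫_4` — KERNEL: `ℓ ≡ 1 (mod 81)`, `#Ẽ(𝔽_{5023}) = 5103 = 81·63` (`countPointsFast`; `a_ℓ = -79 ≡ ℓ + 1 (mod 81)`), cube test `Δ^{(ℓ−1)/3} ≡ 953 ≢ 1 (mod 5023)` (cyclic `3`-part; engine K: `Ẽ(𝔽_ℓ) ≅ ℤ/5103`, `#Ẽ[3] = 3`), class X7 (`#Ẽ(𝔽₃) = 4`, additive at `2`), minimality, surj(3)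 (`surj_x7r1_222784n1_3`); BINDER `hδ`: ENGINE K v1.3 (iw-2 `gen12/kp9/engKq.py` sha256 6e4d76b7…, UNCHANGED) run by this seat at depth 4 (R1k4 tier, `q = 81`, `ν = 1`; additive-p3 GEN 24 kit j149024, `HOME/b2b-bsdres-additive-p3/g24/kim81/`; least primitive root 3; 13632432 Dirichlet terms; certificates feq ≤ 2.9e-15, round_resid ≤ 2.3e-13, dft ≤ 6.4e-12, D = 1): `δ̃⁽⁴⁾_ℓ ≡ 54 (mod 81)` (tower [0, 0, 0, 54], `ord₃ = 3 < 4` = Kim's expected order `ord₃ #Ш + ord₃∏c = 3` exactly) — ONE engine at this level (engine M asked / queued); other non-zero levels ℓ = 192133: δ̃ ≡ 54 (mod 81); all levels run (ℓ:δ̃ mod 81) 5023:54, 192133:54, 192781:0. Non-vanishing mod 81 does not depend on the surjective `ψ_ℓ` (ν = 1: a change of `ψ_ℓ` multiplies `δ̃_ℓ` by a unit), so `hδ` is stated for an arbitrary surjective `ψ`. BINDER `hcard` = gen-19 TWO-ENGINE 3-descent lower half `dim Sel₃ = 3` (engine 1 EXACT(bnfcertify1+3sat) j132399 / engine 2 EXACT(bnfcertify1+3sat)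 j132400, dimSha[3]=2; verdict TWO-ENGINE-EXACT-LOWER; `HOME/b2b-bsdres-additive-p3/g19/sha9core/R1SHA2-TABLE.md`). CONDITIONAL on `hK25s` (OPEN); `hCT`/`hGZK`/`hmod` PUBLISHED; `r_an = 1`, `#Ш_an` Cremona. A SECOND conditional route on this cell beside the gen-19/20 rem13 + descent record (tier-D `hK`). Per pair; nothing booked. [claim: Kim2025RefinedTNC, status: under-review] [cite: Kim2025RefinedTNC, Thm. 1.1 (ANNOUNCED, OPEN binder)] [cite: Kim2022StructureSelmer, §1.2.2 and Conj. 1.10] [cite: SilvermanAEC2009, Thm. X.4.2(a) and Thm. X.4.14] [cite: Cremona2006, Table 1 (Cremona label 222784n1)] -/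
theorem bsdp_x7r1kim81_222784n1
    (hK25s : Kim2025.thm11_kimShaLength_of_integralPeriod_OPEN)
    (hCT : exists_casselsTate_pairing (K := ℚ))
    (hGZK : rank_eq_analyticRank_of_analyticRank_le_one) (hmod : hasEntireLFunction_rat)
    (W : WeierstrassCurve ℚ) (hW : W = ⟨0, 0, 0, -821516, 193877776⟩) (hr : W.analyticRank = 1)
    {N : ℕ} [NeZero N] (D : ModularParametrizationData W N)
    (ψ : (ℓ'' : ℕ) → (ZMod ℓ'')ˣ →* Multiplicative (ZMod (3 ^ 4))) (hψ : Function.Surjective (ψ 5023))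
    (hδ : kuriharaNumber D.f (3 ^ 4) 5023 ψ ≠ 0)
    (hcard : 3 ^ 2 ∣ Nat.card (W.selmerGroup ((3 : ℕ) : ℤ)))
    {q : ℚ} (hq : shaAn W = (q : ℂ)) (hv : padicValRat 3 q = 2) : BSDp W 3 := by
  subst hW
  exact X7RankOne.bsdp_three_of_kim2025_OPEN_of_ainvs_of_kuriharaNumber_ne_zero_of_card_selmerGroup_of_countPointsFast
    hK25s hCT hGZK hmod 0 0 0 (-821516) 193877776
    (isGloballyMinimal_of_krausCriterion_bounded 0 0 0 (-821516) 193877776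
      (by decide +kernel) (by decide +kernel) (by decide +kernel))
    (by decide) (n₃ := 4) (by decide +kernel) (by decide) 2 (by norm_num) (by decide) (by decide)
    surj_x7r1_222784n1_3 hr D (k := 4) (by norm_num) (by norm_num)
    5023 (hℓ := ⟨by norm_num⟩) (by norm_num) (by decide) (by decide) (nℓ := 5103)
    (by decide +kernel)
    (by decide) (by decide +kernel) (by decide +kernel) ψ hψ hδ hcard hq hv

/-- **`445280bc1`** (O4@3 = X7@3 ∧ `r_an = 1`; Cremona model `[0, 0, 0, 10648, 234256]`, `N = 445280` = 2^5·5·11^2·23, `#Ш_an = 9`, `∏c_ℓ = 6` (`ord₃ = 1`: Kim's Conj. 1.10 puts the first non-zero prime-level number at depth `k = ord₃ #Ш + ord₃∏c + 1 = 4` — every level-27 number of this row vanished (cc-eng-3 STAGE 1; engine K R1k3), as predicted), `#E(ℚ)_tors = 1`): `BSD(E,3)` from the level-81 Kurihara number at the prime `ℓ = 5023 ∈ 𝒫_4` — KERNEL: `ℓ ≡ 1 (mod 81)`, `#Ẽ(𝔽_{5023}) = 5022 = 81·62` (`countPointsFast`; `a_ℓ = 2 ≡ ℓ + 1 (mod 81)`),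 cube test `Δ^{(ℓ−1)/3} ≡ 4069 ≢ 1 (mod 5023)` (cyclic `3`-part; engine K: `Ẽ(𝔽_ℓ) ≅ ℤ/5022`, `#Ẽ[3] = 3`), class X7 (`#Ẽ(𝔽₃) = 4`, additive at `2`), minimality, surj(3) (`surj_x7r1_445280bc1_3`); BINDER `hδ`: ENGINE K v1.3 (iw-2 `gen12/kp9/engKq.py` sha256 6e4d76b7…, UNCHANGED) run by this seat at depth 4 (R1k4 tier, `q = 81`, `ν = 1`; additive-p3 GEN 24 kit j149026, `HOME/b2b-bsdres-additive-p3/g24/kim81/`; least primitive root 3; 19272935 Dirichlet terms; certificates feq ≤ 3.4e-15, round_resid ≤ 4.3e-14, dft ≤ 6.1e-13, D = 1): `δ̃⁽⁴⁾_ℓ ≡ 27 (mod 81)` (tower [0, 0, 0, 27], `ord₃ = 3 < 4` = Kim's expected order `ord₃ #Ш + ord₃∏c = 3` exactly) — ONE engine at this level (engine M asked / queued); all levels run (ℓ:δ̃ mod 81) 5023:27, 47629:0, 88129:0. Non-vanishing mod 81 does not depend on the surjective `ψ_ℓ` (ν = 1: a change of `ψ_ℓ` multiplies `δ̃_ℓ`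 by a unit), so `hδ` is stated for an arbitrary surjective `ψ`. BINDER `hcard` = gen-19 TWO-ENGINE 3-descent lower half `dim Sel₃ = 3` (engine 1 EXACT(bnfcertify1+3sat) j132399 / engine 2 LOWERBOUND j136164, dimSha[3]=2; verdict TWO-ENGINE-LOWERBOUND(dim>=3 both; e1 EXACT / LOWERBOUND); `HOME/b2b-bsdres-additive-p3/g19/sha9core/R1SHA2-TABLE.md`). CONDITIONAL on `hK25s` (OPEN); `hCT`/`hGZK`/`hmod` PUBLISHED; `r_an = 1`, `#Ш_an` Cremona. A SECOND conditional route on this cell beside the gen-19/20 rem13 + descent record (tier-D `hK`). Per pair; nothing booked. [claim: Kim2025RefinedTNC, status: under-review] [cite: Kim2025RefinedTNC, Thm. 1.1 (ANNOUNCED, OPEN binder)] [cite: Kim2022StructureSelmer, §1.2.2 and Conj. 1.10] [cite: SilvermanAEC2009, Thm. X.4.2(a) and Thm. X.4.14] [cite: Cremona2006, Table 1 (Cremona label 445280bc1)] -/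
theorem bsdp_x7r1kim81_445280bc1
    (hK25s : Kim2025.thm11_kimShaLength_of_integralPeriod_OPEN)
    (hCT : exists_casselsTate_pairing (K := ℚ))
    (hGZK : rank_eq_analyticRank_of_analyticRank_le_one) (hmod : hasEntireLFunction_rat)
    (W : WeierstrassCurve ℚ) (hW : W = ⟨0, 0, 0, 10648, 234256⟩) (hr : W.analyticRank = 1)
    {N : ℕ} [NeZero N] (D : ModularParametrizationData W N)
    (ψ : (ℓ'' : ℕ) → (ZMod ℓ'')ˣ →* Multiplicative (ZMod (3 ^ 4))) (hψ : Function.Surjective (ψ 5023))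
    (hδ : kuriharaNumber D.f (3 ^ 4) 5023 ψ ≠ 0)
    (hcard : 3 ^ 2 ∣ Nat.card (W.selmerGroup ((3 : ℕ) : ℤ)))
    {q : ℚ} (hq : shaAn W = (q : ℂ)) (hv : padicValRat 3 q = 2) : BSDp W 3 := by
  subst hW
  exact X7RankOne.bsdp_three_of_kim2025_OPEN_of_ainvs_of_kuriharaNumber_ne_zero_of_card_selmerGroup_of_countPointsFast
    hK25s hCT hGZK hmod 0 0 0 10648 234256
    (isGloballyMinimal_of_krausCriterion_bounded 0 0 0 10648 234256
      (by decide +kernel) (by decide +kernel) (by decide +kernel))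
    (by decide) (n₃ := 4) (by decide +kernel) (by decide) 2 (by norm_num) (by decide) (by decide)
    surj_x7r1_445280bc1_3 hr D (k := 4) (by norm_num) (by norm_num)
    5023 (hℓ := ⟨by norm_num⟩) (by norm_num) (by decide) (by decide) (nℓ := 5022)
    (by decide +kernel)
    (by decide) (by decide +kernel) (by decide +kernel) ψ hψ hδ hcard hq hv

end Summit.BirchSwinnertonDyer.Rank1Residual.Supersingular

end
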